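import Literature.Probability.RandomPlanarGeometry.HexSAWPolygonStepTwo
import HarnessLib

/-!
# XLVI — the top hexagon of an OMEGA image has at most two contacts

Topic `Literature/Probability/RandomPlanarGeometry` (lane «pcv-sawmu», a-p4 g23; sequel of XLIV `HexSAWPolygonStepTwo` (`contacts_of_rayTop`) and XLI–XLIII
(`base_shapes`, `profile_insert_of_case2`, `profile_roof_of_case2`, `leaf_shape_of_case2`)).

A structural property of the image of the injection `ι = omegaImage` (THEOREM-OMEGA-g21 §4, read off the five CASE-2 shapes and the ray tops): at the top
hexagon `w` of `W = ι S` the three lower neighbours `L w`, `LL w`, `LR w` are never all present — a ray top is a leaf (XXXVIII/XLIV), the class-R top `a_k` misses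
`LR w = e_k` (XLII), the leaf tops have one contact (XLIII), and ★ the tops of the class-X flip and of the RU flip miss `L w` (`notMem_L_top_of_insert_case2`,
new here: a peeled hexagon at `L w` would stand on the host `LL (L w)` whose right neighbour `LL w` is in the base).  Hence ★★ `card_contacts_top_omegaImage_le_two`:
`#(nbrs w ∩ ι S) ≤ 2`.  Consequence for the heir (not proved here): every `(N+2)`-gon whose top hexagon has three contacts (e.g. the two-row rhombi) lies
outside the image of `ι_N`, so `q_N(ℍ) < q_{N+2}(ℍ)` strictly would follow from exhibiting one such polygon of each even perimeter `≥ 14`.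

Sources: N. Madras, G. Slade, *The Self-Avoiding Walk* (1993), §3.2, proof of Theorem 3.2.3 pp. 64–65 [MadrasSlade1993]; I. Jensen, J. Phys.: Conf. Ser. 42
(2006) 163, §2 [Jensen2006HoneycombPolygons].  Label (lane): LANE INFRASTRUCTURE (structure of the OMEGA image); nothing new in writing.
-/

open Finset

namespace Literature.Probability.RandomPlanarGeometry.SAW

namespace HexCell

variable {S : Finset Cell} {w : Cell}

/-- ★ **The flip tops miss `L w`.** In CASE 2 with `C(B) = B + w`, `LL w ∈ B` and `w` above the top row of `B` (class X: `w = UL t`; RU flip: `w = UL c_j`),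
`L w ∉ ι S`: it is not in the base image (wrong row / not `w`), and a peeled hexagon there would stand on the host `LL (L w)`, whose right neighbour
`R (LL (L w)) = LL w` lies in the base — hosts have a free right neighbour. [cite: MadrasSlade1993, §3.2 (proof of Theorem 3.2.3)] -/
theorem notMem_L_top_of_insert_case2 (hS : IsBrickSet S) (hP : IsPolygon brickWallGraph (bdry S)) (h2 : 2 ≤ #(peel S))
    (hw : IsLexmax (omegaImage S) w) (hwC : w ∈ baseImage (peel S)) (hI : baseImage (peel S) = insert w (peel S))
    (hLL : LL w ∈ peel S) (hrow : (topCell (peel S)).2 < w.2) : L w ∉ omegaImage S := by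
  classical
  have hne : (peel S).Nonempty := card_pos.1 (by omega)
  have ht := isLexmax_topCell hne
  rw [mem_omegaImage_iff_of_case2 hS hP h2 hw hwC, not_or]
  constructor
  · rw [hI, mem_insert, not_or]
    refine ⟨fun e => ?_, ht.notMem_of_row_lt (by simp; omega)⟩
    have := congrArg Prod.fst e; simp at this
  · refine notMem_sdiff_of_case2 hS hP h2 hw hwC rfl fun _ hR _ _ => hR ?_
    have e : R (LL (L w)) = LL w := Prod.ext (by simp; ring) (by simp)
    rw [e]; exact hLL

/-- ★★ **The top hexagon of an OMEGA image never has all three lower neighbours.** For an admissible `S` (brick set, polygonal boundary, `#peel ≥ 2`) and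
the top hexagon `w` of `W = ι S`: `¬ (L w ∈ W ∧ LL w ∈ W ∧ LR w ∈ W)`. [cite: MadrasSlade1993, §3.2 (proof of Theorem 3.2.3)] -/
theorem not_three_contacts_top_omegaImage (hS : IsBrickSet S) (hP : IsPolygon brickWallGraph (bdry S)) (h2 : 2 ≤ #(peel S))
    (hw : IsLexmax (omegaImage S) w) : ¬ (L w ∈ omegaImage S ∧ LL w ∈ omegaImage S ∧ LR w ∈ omegaImage S) := by
  classical
  rintro ⟨hL, hLLw, hLRw⟩
  -- three distinct present neighbours
  have h3 : 3 ≤ #(nbrs w ∩ omegaImage S) := by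
    have hsub : ({L w, LL w, LR w} : Finset Cell) ⊆ nbrs w ∩ omegaImage S := by
      intro x hx
      simp only [mem_insert, mem_singleton] at hx
      rw [mem_inter, mem_nbrs_iff]
      rcases hx with rfl | rfl | rfl
      · exact ⟨by right; right; right; right; right; rfl, hL⟩
      · exact ⟨by left; rfl, hLLw⟩
      · exact ⟨by right; left; rfl, hLRw⟩
    have hcard : #({L w, LL w, LR w} : Finset Cell) = 3 := by
      rw [card_insert_of_notMem, card_pair]
      · intro e; have := congrArg Prod.fst e; simp only [LL_fst, LR_fst] at this; omega
      · simp only [mem_insert, mem_singleton, not_or]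
        exact ⟨fun e => by have := congrArg Prod.snd e; simp only [L_snd, LL_snd] at this; omega,
          fun e => by have := congrArg Prod.snd e; simp only [L_snd, LR_snd] at this; omega⟩
    exact hcard ▸ card_le_card hsub
  by_cases hwC : w ∈ baseImage (peel S)
  swap
  · -- a ray top is a leaf
    have := (contacts_of_rayTop hS hP h2 hw hwC).1; omega
  -- CASE 2: by shape
  obtain ⟨hb, hpoly, hfix⟩ := peel_hyps hS hP
  have hne : (peel S).Nonempty := card_pos.1 (by omega)
  have ht := isLexmax_topCell hne
  have hwtop := eq_topCell_baseImage_of_case2 hw hwC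
  rcases base_shapes hb hpoly h2 hfix with ⟨hLt, eI, -, hmax⟩ | ⟨hLt, -, eI, -, hk, hmax⟩ | ⟨p, eB, eI, -, -, hmax⟩ |
      ⟨t₀, k, ht₀, -, hk, hrun, hend, htop, hBeq, hsub⟩
  · -- class X: `L w ∉ W`
    have hwt : w = UL (topCell (peel S)) := by rw [hwtop, hmax.eq_topCell]
    have eLL : LL w = L (topCell (peel S)) := by rw [hwt]; exact Prod.ext (by simp only [LL_fst, UL_fst, L_fst]; ring) (by simp)
    exact notMem_L_top_of_insert_case2 hS hP h2 hw hwC (by rw [eI, flipImage, hwt]) (by rw [eLL]; exact hLt) (by rw [hwt]; simp) hL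
  · -- class R: `LR w ∉ W`
    have hwt : w = roofCell (topCell (peel S)) (runLen (peel S) (topCell (peel S)) - 1) := by rw [hwtop, hmax.eq_topCell]
    obtain ⟨-, -, hLR', -, -⟩ := profile_roof_of_case2 hS hP h2 hw hwC rfl rfl hLt hk (by rw [eI, roofImage]) hwt
    exact hLR' hLRw
  · -- the 3-chain: a leaf
    have hwt : w = UL (UR p) := by rw [hwtop, hmax.eq_topCell]
    obtain ⟨-, hleaf, -⟩ := profile_chain3_of_case2 hS hP h2 hw hwC eB eI hwt
    omega
  · rcases hsub with ⟨hfl, eI, -, hmax⟩ | ⟨hfl, eI, -, hmax⟩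
    · -- RU flip: `L w ∉ W`
      have hwt : w = UL (chainCell t₀ (chainIdx ((peel S).erase (topCell (peel S))) t₀)) := by rw [hwtop, hmax.eq_topCell]
      have eLL : LL w = L (chainCell t₀ (chainIdx ((peel S).erase (topCell (peel S))) t₀)) := by
        rw [hwt]; exact Prod.ext (by simp only [LL_fst, UL_fst, L_fst]; ring) (by simp)
      refine notMem_L_top_of_insert_case2 hS hP h2 hw hwC (by rw [eI, ruFlipImage, ← hBeq, hwt]) ?_ (by rw [hwt, htop]; simp) hL
      rw [eLL]; exact erase_subset _ _ hfl
    · -- RU leaf: a leaf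
      have hwt : w = UL (chainCell t₀ (chainIdx ((peel S).erase (topCell (peel S))) t₀)) := by rw [hwtop, hmax.eq_topCell]
      obtain ⟨-, hleaf, -⟩ := profile_ruLeaf_of_case2 hS hP h2 hw hwC rfl ht₀ hk hrun hend htop hBeq rfl hfl eI hwt
      omega

/-- ★★ **At most two contacts at the top of an image.** For an admissible `S` and the top hexagon `w` of `W = ι S`: `#(nbrs w ∩ W) ≤ 2` (the other three
neighbours `R w`, `UR w`, `UL w` lie above / right of the top). [cite: MadrasSlade1993, §3.2 (proof of Theorem 3.2.3)] -/
theorem card_contacts_top_omegaImage_le_two (hS : IsBrickSet S) (hP : IsPolygon brickWallGraph (bdry S)) (h2 : 2 ≤ #(peel S))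
    (hw : IsLexmax (omegaImage S) w) : #(nbrs w ∩ omegaImage S) ≤ 2 := by
  classical
  have hsub : nbrs w ∩ omegaImage S ⊆ ({L w, LL w, LR w} : Finset Cell) := by
    intro x hx
    obtain ⟨hxn, hxW⟩ := mem_inter.1 hx
    simp only [mem_insert, mem_singleton]
    rw [mem_nbrs_iff] at hxn
    rcases hxn with rfl | rfl | rfl | rfl | rfl | rfl
    · right; left; rfl
    · right; right; rfl
    · exact absurd hxW (hw.notMem_of_right (by simp) (by simp))
    · exact absurd hxW (hw.notMem_of_row_lt (by simp))
    · exact absurd hxW (hw.notMem_of_row_lt (by simp))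
    · left; rfl
  by_contra hlt
  have h3 : 3 ≤ #(nbrs w ∩ omegaImage S) := by omega
  -- then the inclusion is an equality and all three lower neighbours are present
  have hcard3 : #({L w, LL w, LR w} : Finset Cell) ≤ 3 := card_le_three
  have heq : nbrs w ∩ omegaImage S = {L w, LL w, LR w} := eq_of_subset_of_card_le hsub (by omega)
  have hall : ∀ x ∈ ({L w, LL w, LR w} : Finset Cell), x ∈ omegaImage S := fun x hx => (mem_inter.1 (heq ▸ hx)).2
  exact not_three_contacts_top_omegaImage hS hP h2 hw
    ⟨hall _ (by simp), hall _ (by simp), hall _ (by simp)⟩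

end HexCell

end Literature.Probability.RandomPlanarGeometry.SAW
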